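import Summits.SmoothPoincare4.SmoothPoincare4.Theorems.SoloInformedPinnedSlopeCertificate

/-!
# Pinned-slope certificate (part 3/3): the `A₅`-slope of the door-(a) sections of length ≤ 7

Solo residency `solo-SmoothPoincare4-informed`, session 14; algebraic core of COMPUTATION 11.38(a)
(slope `x = c + 1`; words SSTStts, SStsttS) of the residency file `paper/poincare-sphere-trick.md`
§11.9 (prose results under adjudication, not theorems of this tree). Companion of
`SoloInformedPinnedSlopeCertificate.lean`, whose certificate machinery (`W`, `evalP`, `relSet`,
`G`, `isEmpty_mulEquiv_int`, namespace `PinnedSlope`) it imports; the twelve words are split over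
three files only to respect the file-length lint.

Geometric provenance (prose + machine computation, not formalised here). `N_P = P ×_c S¹ ⊂ W = S³
×_c S¹` is the mapping torus of complex conjugation on the `c`-invariant punctured Klein bottle `P`
bounded by the trefoil; a cyclically reduced word `w` of odd length in `π₁(P) = F⟨s,t⟩` defines a
section `γ_w ⊂ N_P`. A Dehn filling `N_P(γ_w; α)` with `π₁ ≅ ℤ` is a solid Klein bottle in `S⁴` and
yields an unknotting theorem for a Klein bottle in `S⁴`, hence the standardness of one half of a
Yoshikawa type of homotopy 4-spheres (§11 of the residency file). THEOREM 11.37 there (pseudo-Anosov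
pinning) shows that only the three slopes at distance ≤ 1 from the degeneracy slope of the (pseudo-
Anosov) monodromy can give a solid Klein bottle; two of them are excluded by torsion in a 3-fold
cover, and the third, the 'fake slope' `x_* = c + 1` (homology `ℤ`, all small cyclic covers
homology-cyclic), by an `A₅`-quotient. The presentations below — six generators `a,b,c,d,e` (free
generators of the fibre group `π₁(Σ_{1,4})`) and `y` (orientation-reversing), thirteen relators
(five `τ g τ⁻¹ = ĥ_w(g)` for the normalised monodromy `ĥ_w` and the filled stable letter `τ`, one
cusp relation, five `y g y⁻¹ = ι(g)`, `y² = ι²`, `y τ y⁻¹ = z τ`) — are the output of the residency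
scripts `work/s14/fdtc.py`, `a5cert.py` for `π₁(N_P(γ_w; α_{x_*}))`, taken here as INPUT; what is
kernel-checked is that each presented group maps to `S₅` with non-commuting generator images
(explicit images of all six generators in `A₅`, every relator verified by `decide`), hence is non-
commutative and not isomorphic to `ℤ`.
-/

set_option maxRecDepth 20000

namespace Summit.SmoothPoincare4.SmoothPoincare4.Theorems
namespace PinnedSlopeC

open PinnedSlope

/-! ## The fake-slope filling groups -/

/-- Relators of `π₁(N_P(γ_w; α_{c+1}))`, `w = SSTStts` (`|ĥ_w| = 468`). -/
def R_SSTStts : List W :=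
  [[A, b, a, E, d, B, e, c, D, D, e, B, a, E, D, b, d, C, B, d, e, A, b, c, D, B, d, d, C, E, b,
     D, e, A, b, E, d, B, e, c, D, D, e, B, a, E, d, C, E, b, D, e, A, b, E, d, B, e, B, a, E, D,
     b, c, D, B, d, e, A, b, E, d, d, C, E, b, D, e],
   [A, b, a, E, d, B, e, c, D, D, e, B, a, E, D, b, d, C, B, d, e, A, b, c, D, B, d, d, C, E, b,
     D, e, A, b, E, d, B, e, c, D, D, e, B, a, E, d, C, E, b, D, e, A, b, E, d, B, e, B, a, E, D,
     b, c, D, B, d, e, A, b, E, d, d, C, E, b, D, e],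
   [A, b, c, B, a, E, d, B, e, c, D, D, e, B, a, E, D, b, d, C, B, d, e, A, b, c, D, B, e, B, a,
     E, D, b, d, C, B, d, e, A, b, E, b, d, C, E, b, D, e, B, a, E, d, B, e, c, D, D, b, d, C, B,
     d, e, A, b, c, D, B, d, d, C, E, b, D, e, A, b, E, d, B, e, c, D, D, e, B, a, E, d, C, E, b,
     D, e, A, b, E, d, B, e, B, a, E, D, b, c, D, B, d, e, A, b, E, d, d, C, E, b, D, e],
   [A, b, d, B, a, E, d, B, e, c, D, D, e, B, a, E, D, b, d, C, B, d, e, A, b, E, b, D, e, B, a,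
     E, d, B, e, c, D, D, b, d, C, B, d, e, A, b, c, D, B, d, d, C, E, b, D, e, A, b, E, d, B, e,
     c, D, D, e, B, a, E, d, C, E, b, D, e, A, b, E, d, B, e, B, a, E, D, b, c, D, B, d, e, A, b,
     E, d, d, C, E, b, D, e],
   [A, b, e, B, a, E, d, B, e, c, D, D, e, B, a, E, D, b, d, C, B, d, e, A, b, E, b, D, e, B, a,
     E, d, B, e, c, D, e, A, b, E, d, B, e, B, a, E, D, b, c, D, B, d, e, A, b, E, d, d, C, E, b,
     D, e, A, b, E, d, B, e, c, D, D, e, B, a, E, d, C, E, b, D, e, A, b, E, d, B, e, B, a, E, D,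
     b, c, D, B, d, e, A, b, E, d, d, C, E, b, D, e],
   [B, d, e, A, b, E, b, d, C, E, b, D, e, B, a, E, d, B, e, c, D, D, b, d, C, B, d, e, A, b, c,
     D, B, d, d, C, E, b, D, e, A, b, E, d, B, e, c, D, D, e, B, a, E, d, C, E, b, D, e, A, b, E,
     d, B, e, B, a, E, D, b, c, D, B, d, e, A, b, E, d, d, C, E, b, D, e, A, b, d, C],
   [y, a, Y, c, E],
   [y, b, Y, d, E],
   [y, c, Y, a, E],
   [y, d, Y, b, E],
   [y, e, Y, E],
   [y, y, E],
   [y, A, b, Y, B, a, E, d, B, e, c, D, D, e, B, a, E, D, b, d, C, B, d, e, A, b, E, b, D, e, B,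
     a, E, d, B, e, c, D, e, A, b, E, d, d, C, E, b, D, e, B, a, E, d, B, e, c, D, D, b, d, C, B,
     a, E, D, b, c, D, B, d, d, C, E, b, D, e, A, b, E, d, B, e, c, D, B, e, B, a, E, D, b]]

/-- Generator images in `A₅` for `w = SSTStts`. -/
def f_SSTStts : Fin 6 → Equiv.Perm (Fin 5) :=
  ![Equiv.swap 1 2 * Equiv.swap 2 3,
    Equiv.swap 0 3 * Equiv.swap 1 2,
    Equiv.swap 0 1 * Equiv.swap 1 2 * Equiv.swap 2 3 * Equiv.swap 3 4,
    Equiv.swap 0 1 * Equiv.swap 1 2 * Equiv.swap 2 4 * Equiv.swap 4 3,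
    Equiv.swap 0 1 * Equiv.swap 1 3 * Equiv.swap 3 4 * Equiv.swap 4 2,
    Equiv.swap 0 4 * Equiv.swap 4 1 * Equiv.swap 1 2 * Equiv.swap 2 3]

/-- Every relator of `R_SSTStts` holds for `f_SSTStts`. -/
theorem rels_SSTStts : ∀ L ∈ R_SSTStts, evalP f_SSTStts L = 1 := by decide

/-- Two generator images do not commute. -/
theorem nc_SSTStts : f_SSTStts 2 * f_SSTStts 3 ≠ f_SSTStts 3 * f_SSTStts 2 := by decide

/-- MAIN (SSTStts): the fake-slope filling group of `γ_w`, `w = SSTStts`, is not `ℤ`. -/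
theorem isEmpty_G_SSTStts_mulEquiv_int : IsEmpty (G R_SSTStts ≃* Multiplicative ℤ) :=
  isEmpty_mulEquiv_int R_SSTStts f_SSTStts rels_SSTStts 2 3 nc_SSTStts

/-- Relators of `π₁(N_P(γ_w; α_{c+1}))`, `w = SStsttS` (`|ĥ_w| = 446`). -/
def R_SStsttS : List W :=
  [[A, b, a, c, B, d, C, D, a, E, c, D, e, A, d, C, B, a, c, B, e, A, b, D, a, E, c, D, e, A, d,
     C, B, a, c, B, e, A, b, D, a, E, c, D, e, A, d, B, a, E, b, C, A, b, c, B, d, C, B, a, E, b,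
     C, A, b, c, D, a, E, d, C, e, A, d, c, D, b, C],
   [A, b, a, c, B, d, C, D, a, E, c, D, e, A, d, C, B, a, c, B, e, A, b, D, a, E, c, D, e, A, d,
     C, B, a, c, B, e, A, b, D, a, E, c, D, e, A, d, B, a, E, b, C, A, b, c, B, d, C, B, a, E, b,
     C, A, b, c, D, a, E, d, C, e, A, d, c, D, b, C],
   [A, b, c, B, a, c, B, d, C, D, a, E, c, D, e, A, d, C, B, a, c, B, e, A, b, c, D, b, C, B, a,
     c, B, d, C, D, a, E, c, D, e, A, b, C, B, a, c, B, e, A, b, D, a, E, d, C, e, A, d, B, a, E,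
     b, C, A, b, c, B, a, E, d, C, e, A, d, c, D, e, A, b, C, B, a, c, B, e, A, b, D, a, E, c, D,
     e, A, d, B, a, E, b, C, A, b, c, B, d, C, B, a, E, b, C, A, b, c, D, a, E, d, C, e, A, d, c,
     D, b, C],
   [A, b, d, B, a, c, B, d, C, D, a, E, c, D, e, A, d, C, B, a, c, B, e, A, b, c, D, b, C, B, a,
     c, B, e, A, b, C, B, a, c, B, e, A, b, D, a, E, c, D, e, A, d, B, a, E, b, C, A, b, c, B, d,
     C, B, a, E, b, C, A, b, c, D, a, E, d, C, e, A, d, c, D, b, C],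
   [A, b, e, B, a, c, B, d, C, D, a, E, c, D, e, A, d, C, B, a, c, B, e, A, b, c, D, a, E, d, C,
     e, A, d, c, D, b, C, A, b, c, B, d, C, D, a, E, c, D, e, A, d, C, B, a, c, B, e, A, b, D, a,
     E, c, D, e, A, d, B, a, E, b, C, A, b, c, B, d, C, B, a, E, b, C, A, b, c, D, a, E, d, C, e,
     A, d, c, D, b, C],
   [e, A, d, B, a, E, b, C, A, b, c, B, a, E, d, C, e, A, d, c, D, e, A, b, C, B, a, c, B, e, A,
     b, D, a, E, c, D, e, A, d, B, a, E, b, C, A, b, c, B, d, C, B, a, E, b, C, A, b, c, D, a, E,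
     d, C, e, A, d, c, D, b, C, A, b, d, C],
   [y, a, Y, c, E],
   [y, b, Y, d, E],
   [y, c, Y, a, E],
   [y, d, Y, b, E],
   [y, e, Y, E],
   [y, y, E],
   [y, A, b, Y, B, a, c, B, d, C, D, a, E, c, D, e, A, d, C, B, a, c, B, e, A, b, c, D, b, C, B,
     a, c, B, e, A, b, D, a, E, d, C, e, A, d, B, a, E, b, C, A, b, c, B, a, E, d, C, D, a, E, c,
     D, e, A, b, C, B, a, c, B, e, A, b, D, a, E]]

/-- Generator images in `A₅` for `w = SStsttS`. -/
def f_SStsttS : Fin 6 → Equiv.Perm (Fin 5) :=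
  ![Equiv.swap 0 1 * Equiv.swap 3 4,
    Equiv.swap 0 3 * Equiv.swap 3 2 * Equiv.swap 2 1 * Equiv.swap 1 4,
    Equiv.swap 0 1 * Equiv.swap 1 2 * Equiv.swap 2 3 * Equiv.swap 3 4,
    1,
    Equiv.swap 0 3 * Equiv.swap 3 2 * Equiv.swap 2 1 * Equiv.swap 1 4,
    Equiv.swap 0 1 * Equiv.swap 1 3 * Equiv.swap 3 4 * Equiv.swap 4 2]

/-- Every relator of `R_SStsttS` holds for `f_SStsttS`. -/
theorem rels_SStsttS : ∀ L ∈ R_SStsttS, evalP f_SStsttS L = 1 := by decide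

/-- Two generator images do not commute. -/
theorem nc_SStsttS : f_SStsttS 2 * f_SStsttS 5 ≠ f_SStsttS 5 * f_SStsttS 2 := by decide

/-- MAIN (SStsttS): the fake-slope filling group of `γ_w`, `w = SStsttS`, is not `ℤ`. -/
theorem isEmpty_G_SStsttS_mulEquiv_int : IsEmpty (G R_SStsttS ≃* Multiplicative ℤ) :=
  isEmpty_mulEquiv_int R_SStsttS f_SStsttS rels_SStsttS 2 5 nc_SStsttS
end PinnedSlopeC
end Summit.SmoothPoincare4.SmoothPoincare4.Theorems
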